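import Summits.BirchSwinnertonDyer.BirchSwinnertonDyer.Theorems.PrintCf2SplitBadTwoCMScalarAtV
import Summits.BirchSwinnertonDyer.BirchSwinnertonDyer.Theorems.PrintCf2SplitBadTwoF3CountsOfPlainRoad
import HarnessLib

/-!
# Crux `PrintCf2.SplitBadTwoRankOneOfFacts` (stmt-BirchSwinnertonDyer-20368), road α v10.5, S3c/S3b′ — THE CM SCALAR AT `v` WITHOUT
# `Finite 𝔖_{v̄}(K, W*)`: it follows from the LOCAL statement (ET-v) «the `W*`-component of every Kummer class is 2-torsion on `D_v`»

Cell `bsd-print-cf2`, EXTRA WIDTH seat `bsd-line-cf2-p1-w3` g10 (prover-bsd-line-cf2-p1-w3-g10-0); `--supports stmt-BirchSwinnertonDyer-20368`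
(helper, Theses-free). HONEST FRAMING: nothing here closes the crux or a registered stub; BSD is not proved by any of this; no summit statement
is proved by this seat. No definition, no named fact, no `sorry`, no kit. beyond-print theorem: no.

WHY (-w4 g10 FINDING 2026-08-29T00:29:37Z). Files 1–4 of this seat decide the CM scalar at the pinned place `v` (`1 − r`, not `r`) from (H1′),
and (H1′) (-w3 g9 `comap_kummer_le_ker_resOfLe_of_frame_of_cyclic`) excludes the wrong branch through hfinB′ := `ConjTransport…(hfin)` — i.e.
THROUGH `Finite 𝔖_{v̄}(K, W*)` ITSELF. For S3b′ (v10.5 brick (FIN)/(BF): «`Finite Ш ⟹ Finite 𝔖_{v̄}(K, W*)`», -w4 g10) this is circular: an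
hfin-FREE decision of the branch is needed. THIS FILE isolates the exact LOCAL input that does it and proves the implication:
* (ET-v) «for every equivariant projector `e` onto `W* = E[𝔮_r^∞]` killing `W*′`, every `K`-point `Q` and every level `n`:
  `2 • res_{D_v} (e_* res_⊤ κ_n(Q)) = 0`» — the `W*`-component of a Kummer class is 2-TORSION on the decomposition group at `v`
  (Greenberg LNM 1716 §2 Prop. 2.2: on the inertia of `K_v(√d)` a Kummer cocycle takes values in the kernel-of-reduction line of the good
  twist, which at `v` is `W*′` by -w2 g8 `endEigenPrimaryTorsion_two_isOrdinaryFiltrationDatum_of_pinned` (p655423); the residual class lives on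
  a group with `H¹ ≤ ℤ/2`). (ET-v) is NOT proved here (brick for a transport seat: X2 `reductionDatum_kummer` along -w2 g6's twist/base-change
  chain p639983/p640618/p657262).
* §1 `isOfFinAddOrder_of_cmScalar_eq_root_of_two_nsmul` — GENERIC twin of `isOfFinAddOrder_of_cmScalar_eq_root` (p679879) with (H1′) replaced
  by the 2-torsion statement for ONE point `PK`: if the scalar were `r`, (H1″) for `W*′` (-w8 g2, at the conjugate root) kills the
  `W*′`-component of the class of `2•PK` at `v` (it is classical at `v`: the `W*`-component of the class of `2•PK` is ZERO at `v`), so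
  `loc_v res_⊤ κ_n(2•PK) = 0` for all `n`, `2•PK` is divisible modulo torsion in `E(K_v)`, hence torsion.
* §2 **`cmScalar_localPoints_of_frame_of_etale`** — ON EVERY S3c FRAME WITHOUT `Finite 𝔖`: (ET-v) ⟹ the scalar is `1 − r` (m-form, as
  `cmScalar_localPoints_of_frame`); hence (by files 1–4 verbatim) hPts / (H1′) / (PIN) become hfin-free the moment (ET-v) lands.
* (MW-v̄) of -w4 g10's (BF) follows the same way from the twin (ET-v̄) «`2 • res_{D_v̄}(e′_* res_⊤ κ_n(Q)) = 0`» (the `W*′`-component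
  at `v̄`, where `W*` is the kernel line, p655423 `…_at_conj`) — left to the (BF) file.
presearch: Greenberg LNM 1716 §2 Props. 2.1–2.4 [corpus: GreenbergLNM1716 pp. 62–63, 70–75] (the kernel-line argument); Rubin LNM 1716 §3 Lemma 3.6 (ii);
no Literature fact filed. playbook: none fit.

References: [GreenbergLNM1716] §2 Props. 2.1–2.4; [Rubin1999] §3 Lemma 3.6 (ii); [Agboola2007] §6 Prop. 6.11, Thm. 6.12; [SilvermanAEC2009]
Prop. VII.6.3, VIII §2.
-/

noncomputable section

open scoped Classical

set_option linter.dupNamespace false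
set_option autoImplicit false

open NumberField IsDedekindDomain Field WeierstrassCurve
open Literature.NumberTheory.EllipticCurves Literature.NumberTheory.EllipticCurves.GreenbergSelmer
open Literature.NumberTheory.EllipticCurves.Castella2018.AcSelmer
open Literature.NumberTheory.EllipticCurves.Agboola2007
open Literature.NumberTheory.EllipticCurves.ResKernel
open Literature.NumberTheory.GaloisRepresentations

namespace Summit.BirchSwinnertonDyer.BirchSwinnertonDyer.Theorems.PrintCf2.CMPrimes

open Summit.BirchSwinnertonDyer.BirchSwinnertonDyer.Theorems.PrintCf2.RestrictedSelmerPair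
open Summit.BirchSwinnertonDyer.BirchSwinnertonDyer.Theorems.PrintCf2.AdditiveAtSeven
open Summit.BirchSwinnertonDyer.BirchSwinnertonDyer.Theorems.PrintCf2.LocalTrichotomy
open Summit.BirchSwinnertonDyer.BirchSwinnertonDyer.Theorems.PrintCf2.LocalPointsScalar
open Summit.BirchSwinnertonDyer.BirchSwinnertonDyer.Theorems.PrintCf2

variable {K : Type} [Field K] [NumberField K]

/-! ## §1. The branch `c = r` is impossible, from the 2-torsion of the `W*`-components at `v` -/

/-- **The branch `c = r` is impossible (hfin-free form).** `K` quadratic with `2 = v·v̄`, `V/K` elliptic, `π ∈ End_K(V)`, `r² = r − 2` with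
complementary eigen-summands, `e` an equivariant projector onto `W* = E[𝔮_r^∞]` killing `W*′`, `φ` an isogeny acting as `π`, `PK` a `K`-point.
IF the `W*`-component of every level-`n` Kummer class of `PK` is `2`-torsion on `D_v` AND `π` acted on `E(K_v)/tors` as the scalar `r`, THEN
`PK` is torsion. [cite: GreenbergLNM1716, §2 Prop. 2.1–2.2] [cite: Agboola2007, §6 Prop. 6.11 (arXiv p0014)] [cite: SilvermanAEC2009, Prop. VII.6.3] -/
theorem isOfFinAddOrder_of_cmScalar_eq_root_of_two_nsmul (hK2 : Module.finrank ℚ K = 2)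
    {v vbar : HeightOneSpectrum (𝓞 K)} (hv : ((2 : ℕ) : 𝓞 K) ∈ v.asIdeal) (hvbar : ((2 : ℕ) : 𝓞 K) ∈ vbar.asIdeal) (hne : vbar ≠ v)
    (V : WeierstrassCurve K) [V.IsElliptic] (π : V.endRing) {r : ℤ_[2]} (hr : r * r = r - 2)
    (hinf : V.endEigenPrimaryTorsion 2 π r ⊓ V.endEigenPrimaryTorsion 2 π (1 - r) = ⊥)
    (hsup : V.endEigenPrimaryTorsion 2 π r ⊔ V.endEigenPrimaryTorsion 2 π (1 - r) = ⊤)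
    (φ : Isogeny V V) (hφ : ∀ Q, φ Q = (π : AddMonoid.End V.geomPoints) Q)
    (e : V.geomPrimaryTorsion 2 →+ ↥(V.endEigenPrimaryTorsion 2 π r))
    (he₁ : ∀ x : ↥(V.endEigenPrimaryTorsion 2 π r), e x = x)
    (he0 : ∀ x ∈ V.endEigenPrimaryTorsion 2 π (1 - r), e x = 0)
    (he : ∀ (σ : absoluteGaloisGroup K) (x : V.geomPrimaryTorsion 2), e (σ • x) = σ • e x)
    (PK : V.toAffine.Point)
    (h1 : ∀ n : ℕ, 2 • resOfLe ↥(V.endEigenPrimaryTorsion 2 π r) (inf_le_left : ⊤ ⊓ decomp v ≤ ⊤)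
        (resH1Hom (ContinuousMonoidHom.id (⊤ : Subgroup (absoluteGaloisGroup K))) e (fun σ x ↦ he σ x)
          (resSubgroup ⊤ (V.geomPrimaryTorsion 2) (V.kummerMapLevel 2 V.zsmul_geomPoints_surjective_holds n PK))) = 0)
    (H : ∀ y : localPoints V (v.adicCompletion K), (∀ σ : absoluteGaloisGroup (v.adicCompletion K), σ • y = y) →
      ∀ n : ℕ, ∃ (y' : localPoints V (v.adicCompletion K)) (N₁ : ℤ) (m : ℤ),
        (∀ σ : absoluteGaloisGroup (v.adicCompletion K), σ • y' = y') ∧ m ≠ 0 ∧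
        ((N₁ : ℤ_[2]) - r) ∈ (Ideal.span {(2 : ℤ_[2]) ^ n} : Ideal ℤ_[2]) ∧
        m • (φ.localPointsMap (v.adicCompletion K) y - N₁ • y - 2 ^ n • y') = 0) :
    IsOfFinAddOrder PK := by
  haveI : Fact (Nat.Prime 2) := ⟨Nat.prime_two⟩
  set E := v.adicCompletion K with hE
  have hunit : IsUnit (r - (1 - r)) := (two_dvd_or_two_dvd_one_sub_of_root hr).2
  -- (H1″) for the conjugate summand `E[𝔮_{1-r}^∞]`, from the scalar `r = 1 - (1 - r)` (-w8 g2 at the root `1 - r`)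
  have hinf' : V.endEigenPrimaryTorsion 2 π (1 - r) ⊓ V.endEigenPrimaryTorsion 2 π (1 - (1 - r)) = ⊥ := by
    rw [sub_sub_cancel, inf_comm]; exact hinf
  have hsup' : V.endEigenPrimaryTorsion 2 π (1 - r) ⊔ V.endEigenPrimaryTorsion 2 π (1 - (1 - r)) = ⊤ := by
    rw [sub_sub_cancel, sup_comm]; exact hsup
  have hunit' : IsUnit ((1 - r) - (1 - (1 - r))) := by
    rw [sub_sub_cancel, ← neg_sub]; exact hunit.neg
  have H' : ∀ y : localPoints V E, (∀ σ : absoluteGaloisGroup E, σ • y = y) →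
      ∀ n : ℕ, ∃ (y' : localPoints V E) (N₁ : ℤ) (m : ℤ), (∀ σ : absoluteGaloisGroup E, σ • y' = y') ∧ m ≠ 0 ∧
        ((N₁ : ℤ_[2]) - (1 - (1 - r))) ∈ (Ideal.span {(2 : ℤ_[2]) ^ n} : Ideal ℤ_[2]) ∧
        m • (φ.localPointsMap E y - N₁ • y - 2 ^ n • y') = 0 := fun y hy n ↦ by
    obtain ⟨y', N₁, m, h1, h2, h3, h4⟩ := H y hy n
    exact ⟨y', N₁, m, h1, h2, by rwa [sub_sub_cancel], h4⟩
  have h1'' := comap_localKerOver_le_ker_resOfLe_of_cmScalar_torsion V 2 π (1 - r) v hinf' hsup' hunit'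
    (φ.localPointsMap E) (φ.localPointsMap_smul E) (fun Q ↦ by rw [φ.localPointsMap_pointsMap, hφ]) H'
  -- the complementary equivariant projector
  obtain ⟨e', he'₁, he', hsum⟩ := SelmerLocImage.exists_compl_projector V 2 π r (1 - r) e he₁ he0 he hsup
  -- every level-`n` Kummer class of `2 • PK` dies on `D_v`
  have hvan : ∀ n : ℕ, resOfLe (V.geomPrimaryTorsion 2) (inf_le_left : ⊤ ⊓ decomp v ≤ ⊤)
      (resSubgroup ⊤ (V.geomPrimaryTorsion 2) (V.kummerMapLevel 2 V.zsmul_geomPoints_surjective_holds n (2 • PK))) = 0 := by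
    intro n
    set x := resSubgroup ⊤ (V.geomPrimaryTorsion 2) (V.kummerMapLevel 2 V.zsmul_geomPoints_surjective_holds n (2 • PK)) with hx
    have hx2 : x = 2 • resSubgroup ⊤ (V.geomPrimaryTorsion 2) (V.kummerMapLevel 2 V.zsmul_geomPoints_surjective_holds n PK) := by
      rw [hx, map_nsmul, map_nsmul]
    have hxQ : x ∈ ((V.kummerMapPInfty 2 V.zsmul_geomPoints_surjective_holds).range).map (resSubgroup ⊤ (V.geomPrimaryTorsion 2)) := by
      refine ⟨V.kummerMapPInfty 2 V.zsmul_geomPoints_surjective_holds ((2 • PK) ⊗ₜ prufGen 2 n), ⟨_, rfl⟩, ?_⟩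
      rw [kummerMapPInfty_tmul_prufGen, hx]
    have hdec := resH1Hom_subtype_proj_add_eq V 2 π r (1 - r) ⊤ e e' he he' hsum x
    -- the `W*`-component of the class of `2 • PK` is ZERO at `v` (twice the `W*`-component of the class of `PK`), hence classical at `v`
    have he0 : resOfLe ↥(V.endEigenPrimaryTorsion 2 π r) (inf_le_left : ⊤ ⊓ decomp v ≤ ⊤)
        (resH1Hom (ContinuousMonoidHom.id (⊤ : Subgroup (absoluteGaloisGroup K))) e (fun σ x ↦ he σ x) x) = 0 := by
      rw [hx2, map_nsmul, map_nsmul]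
      exact h1 n
    have hecl := ker_resOfLe_le_comap_localKerOver V 2 π r v (AddMonoidHom.mem_ker.mpr he0)
    rw [AddSubgroup.mem_comap] at hecl
    -- the `W*′`-component is classical at `v` (difference of two classical classes), hence zero at `v` by (H1″)′
    have hxcl : x ∈ V.localKerOver 2 ⊤ E :=
      ((map_resSubgroup_kummer_le_map_resSubgroup_selmer V 2).trans (map_resSubgroup_selmer_le_localKerOver_adicCompletion V 2 v)) hxQ
    have he'cl : resH1Hom (ContinuousMonoidHom.id (⊤ : Subgroup (absoluteGaloisGroup K))) e' (fun σ x ↦ he' σ x) x ∈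
        (V.localKerOver 2 ⊤ E).comap
          (resH1Hom (ContinuousMonoidHom.id (⊤ : Subgroup (absoluteGaloisGroup K))) (V.endEigenPrimaryTorsion 2 π (1 - r)).subtype
            (fun _ _ ↦ rfl)) := by
      rw [AddSubgroup.mem_comap]
      have heq : resH1Hom (ContinuousMonoidHom.id (⊤ : Subgroup (absoluteGaloisGroup K))) (V.endEigenPrimaryTorsion 2 π (1 - r)).subtype
            (fun _ _ ↦ rfl) (resH1Hom (ContinuousMonoidHom.id (⊤ : Subgroup (absoluteGaloisGroup K))) e' (fun σ x ↦ he' σ x) x) =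
          x - resH1Hom (ContinuousMonoidHom.id (⊤ : Subgroup (absoluteGaloisGroup K))) (V.endEigenPrimaryTorsion 2 π r).subtype
            (fun _ _ ↦ rfl) (resH1Hom (ContinuousMonoidHom.id (⊤ : Subgroup (absoluteGaloisGroup K))) e (fun σ x ↦ he σ x) x) :=
        eq_sub_of_add_eq' hdec
      rw [heq]
      exact sub_mem hxcl hecl
    have he'0 : resOfLe ↥(V.endEigenPrimaryTorsion 2 π (1 - r)) (inf_le_left : ⊤ ⊓ decomp v ≤ ⊤)
        (resH1Hom (ContinuousMonoidHom.id (⊤ : Subgroup (absoluteGaloisGroup K))) e' (fun σ x ↦ he' σ x) x) = 0 :=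
      AddMonoidHom.mem_ker.mp (h1'' he'cl)
    rw [← hdec, map_add, resOfLe_resH1Hom_subtype V 2 π r, resOfLe_resH1Hom_subtype V 2 π (1 - r), he0, he'0, map_zero, map_zero,
      add_zero]
  -- so `2 • PK ∈ 2^n E(K_v) + tors` for every `n`: `2 • PK`, hence `PK`, is torsion
  suffices h2PK : IsOfFinAddOrder (2 • PK) by
    obtain ⟨m, hm0, hm⟩ := isOfFinAddOrder_iff_nsmul_eq_zero.mp h2PK
    exact isOfFinAddOrder_iff_nsmul_eq_zero.mpr ⟨m * 2, by positivity, by rw [mul_nsmul', hm]⟩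
  haveI : CharZero E := charZero_of_injective_algebraMap (algebraMap K E).injective
  haveI : (V.baseChange E).IsElliptic := inferInstanceAs ((V.map (algebraMap K E)).IsElliptic)
  set Pimg : localPoints V E := pointsMap V E (toGeomPoints V (2 • PK)) with hPimg
  set ψ : (V.baseChange E).toAffine.Point →+ localPoints V E :=
    Affine.Point.map (W' := V) (IsScalarTower.toAlgHom K E (AlgebraicClosure E)) with hψ
  have hψinj : Function.Injective ψ :=
    Affine.Point.map_injective (W' := V) (IsScalarTower.toAlgHom K E (AlgebraicClosure E))
  have hPfix : ∀ σ : absoluteGaloisGroup E, σ • Pimg = Pimg := fun σ ↦ by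
    rw [hPimg, ← pointsMap_smul, smul_toGeomPoints]
  obtain ⟨x₀, hx₀⟩ := exists_map_eq_of_forall_smul_localPoints_eq V E hPfix
  have hx₀' : ψ x₀ = Pimg := hx₀
  have hx₀t : IsOfFinAddOrder x₀ := by
    refine isOfFinAddOrder_of_forall_exists_adicCompletion_two hK2 hv hvbar hne (V.baseChange E) (fun n ↦ ?_)
    obtain ⟨y, T, hy, hT, hyT⟩ := (resOfLe_resSubgroup_kummerMapLevel_eq_zero_iff V 2 v (2 • PK) n).mp (hvan n)
    obtain ⟨Y, hY⟩ := exists_map_eq_of_forall_smul_localPoints_eq V E hy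
    have hY' : ψ Y = y := hY
    refine ⟨Y, ?_⟩
    have h2 : ((2 : ℤ) ^ n) • y + T = Pimg := by
      have e1 : ((2 : ℤ) ^ n) • y = 2 ^ n • y := by
        rw [← natCast_zsmul y (2 ^ n), Nat.cast_pow, Nat.cast_ofNat]
      rw [e1]
      exact hyT
    have hTeq : ψ (x₀ - ((2 : ℤ) ^ n) • Y) = T := by
      rw [map_sub, map_zsmul, hx₀', hY', ← h2, add_sub_cancel_left]
    exact (hψinj.isOfFinAddOrder_iff).mp (hTeq ▸ hT)
  have hPimgt : IsOfFinAddOrder Pimg := hx₀' ▸ ψ.isOfFinAddOrder hx₀t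
  have hinj : Function.Injective (pointsMap V E) := pointsMapOfEmb_injective V (closureEmb (K := K) E)
  rw [hPimg, hinj.isOfFinAddOrder_iff, (toGeomPoints_injective V).isOfFinAddOrder_iff] at hPimgt
  exact hPimgt


/-! ## §2. On the frame WITHOUT `Finite 𝔖_{v̄}(K, W*)`: (ET-v) decides the scalar -/

/-- **THE CM SCALAR AT `v` IS `1 − r`, from (ET-v), with NO `Finite 𝔖` hypothesis.** On an S3c frame prefix (`C • W = cm7^{(d)}`, `d ≠ 0`;
`K` imaginary quadratic, `2 = v·v̄`; `π² = π − 2`; `r² = r − 2`; `P ∈ W(ℚ)` of infinite order) — no pinning clause and no finiteness is used —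
IF (ET-v) holds («`2 • res_{D_v}(e_* res_⊤ κ_n(Q)) = 0` for every equivariant projector `e` onto `E[𝔮_r^∞]` killing `E[𝔮_{1−r}^∞]`, every
`K`-point `Q`, every `n`»), THEN for the isogeny `φ` realising `π`, every `Γ_{K_v}`-fixed `y ∈ E(K̄_v)` and every `n`:
`m·(φ_{K_v} y − N₁ y − 2^n y′) = 0` with `y′` fixed, `N₁ ≡ 1 − r (mod 2^n)`, `m ≠ 0`. [cite: Rubin1999, §3 Lemma 3.6 (ii), Cor. 3.17]
[cite: GreenbergLNM1716, §2 Prop. 2.2] [cite: SilvermanAEC2009, Prop. VII.6.3] -/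
theorem cmScalar_localPoints_of_frame_of_etale {d : ℤ} (hd0 : d ≠ 0) (W : WeierstrassCurve ℚ) [W.IsElliptic]
    (C : VariableChange ℚ) (hCW : C • W = cm7.quadraticTwist (d : ℚ)) (hK : IsImaginaryQuadratic K)
    (v vbar : HeightOneSpectrum (𝓞 K)) (hv : ((2 : ℕ) : 𝓞 K) ∈ v.asIdeal) (hvbar : ((2 : ℕ) : 𝓞 K) ∈ vbar.asIdeal) (hne : vbar ≠ v)
    (π : (W.baseChange K).endRing) (hrel : (π : AddMonoid.End (W.baseChange K).geomPoints) * π = π - 2)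
    {r : ℤ_[2]} (hr : r * r = r - 2) (P : W.toAffine.Point) (hP : ¬ IsOfFinAddOrder P)
    (hET : ∀ (e : (W.baseChange K).geomPrimaryTorsion 2 →+ ↥((W.baseChange K).endEigenPrimaryTorsion 2 π r))
        (he₁ : ∀ x : ↥((W.baseChange K).endEigenPrimaryTorsion 2 π r), e x = x)
        (he0 : ∀ x ∈ (W.baseChange K).endEigenPrimaryTorsion 2 π (1 - r), e x = 0)
        (he : ∀ (σ : absoluteGaloisGroup K) (x : (W.baseChange K).geomPrimaryTorsion 2), e (σ • x) = σ • e x)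
        (Q : (W.baseChange K).toAffine.Point) (n : ℕ),
        2 • resOfLe ↥((W.baseChange K).endEigenPrimaryTorsion 2 π r) (inf_le_left : ⊤ ⊓ decomp v ≤ ⊤)
          (resH1Hom (ContinuousMonoidHom.id (⊤ : Subgroup (absoluteGaloisGroup K))) e (fun σ x ↦ he σ x)
            (resSubgroup ⊤ ((W.baseChange K).geomPrimaryTorsion 2)
              ((W.baseChange K).kummerMapLevel 2 (W.baseChange K).zsmul_geomPoints_surjective_holds n Q))) = 0)
    (φ : Isogeny (W.baseChange K) (W.baseChange K)) (hφ : ∀ Q, φ Q = (π : AddMonoid.End (W.baseChange K).geomPoints) Q) :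
    ∀ y : localPoints (W.baseChange K) (v.adicCompletion K), (∀ σ : absoluteGaloisGroup (v.adicCompletion K), σ • y = y) →
      ∀ n : ℕ, ∃ (y' : localPoints (W.baseChange K) (v.adicCompletion K)) (N₁ : ℤ) (m : ℤ),
        (∀ σ : absoluteGaloisGroup (v.adicCompletion K), σ • y' = y') ∧ m ≠ 0 ∧
        ((N₁ : ℤ_[2]) - (1 - r)) ∈ (Ideal.span {(2 : ℤ_[2]) ^ n} : Ideal ℤ_[2]) ∧
        m • (φ.localPointsMap (v.adicCompletion K) y - N₁ • y - 2 ^ n • y') = 0 := by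
  haveI : Fact (Nat.Prime 2) := ⟨Nat.prime_two⟩
  have hφ2 : ∀ Q, φ (φ Q) = φ Q - 2 • Q := fun Q ↦ by rw [hφ, hφ, cmEndo_apply_apply (W.baseChange K) hrel Q]
  obtain ⟨c, hc, H⟩ := cmScalar_dichotomy_localPoints hK.1 hv hvbar hne (W.baseChange K) φ hφ2 hr
  rcases hc with hc | hc
  · -- the branch `c = r` is impossible: the ℚ-generator would be torsion
    exfalso
    subst hc
    obtain ⟨hinf, hsup⟩ := endEigenPrimaryTorsion_compl_of_frame hd0 W C hCW K π hrel hr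
    obtain ⟨e, he₁, he₂, -, he⟩ := exists_eigenProjector (W.baseChange K) 2 π c (1 - c) hinf hsup
    exact not_isOfFinAddOrder_map_ofId W hP
      (isOfFinAddOrder_of_cmScalar_eq_root_of_two_nsmul hK.1 hv hvbar hne (W.baseChange K) π hr hinf hsup φ hφ e he₁ he₂ he
        (Affine.Point.map (W' := W.toAffine) (Algebra.ofId ℚ K) P)
        (fun n ↦ hET e he₁ he₂ he _ n) H)
  · subst hc
    exact H


end Summit.BirchSwinnertonDyer.BirchSwinnertonDyer.Theorems.PrintCf2.CMPrimes

end
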